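import Summits.QuantumFields.YangMills.Theorems.LuscherReductionDressedRitzPolyakovLiftBlockPositionGlue
import Summits.QuantumFields.YangMills.Theorems.LuscherReductionDressedRitzPolyakovLiftBlockLeakage
import Summits.QuantumFields.YangMills.Theorems.LuscherReductionDressedRitzPolyakovLiftPScalingLevels
import HarnessLib

/-!
# Route `LuscherReduction`, item `DressedRitz` (stmt-QuantumFields-20205), line «polyakovlift» — ★★ POSITION FROM BLOCK DATA, the `…ForL` assembly:
# `LiftPositionForL P ⟸ BlockPositionForL P ∧ BlockLeakageForL P ∧ StaticsForL P` (LEAD prover ym-lead-20205-polyakovlift g4, task W4-A; `--supports 20205`)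

The per-basis engine `dynamicCoreClauses_of_block` (`…BlockPositionGlue.lean`) turns L-FREE block data into the fine dynamic core (o5)(o6).  Its side conditions on the
block Rayleigh quotients `X_i = ⟨u_i,K^Lu_i⟩/‖u_i‖²` — comparability `X_i ≤ Θ₁X_l`, mismatch `|X_i − X_l| ≤ ηX_l` with `η = O(λ)`, top `λ₀^L ≤ Θ₁X_i` — follow from the
block position (B5) `X_i = e^{±a}(μ_{i+1}λ₀/μ₀)^L` and the closed crux ONE in uniform two-sided form (`PScal.exists_uniform_twoSided`:
`μ_j(B) = linkC(B)³·e^{−ε_{j+1}x ± Cx²}`, `x = bareLambda B = λ/L` at `B = oneSiteCoupling β L`), which give the WINDOW `X_i = λ₀^L·e^{θ_i}`,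
`|θ_i| ≤ a + ε_{i+2}λ + 2Cλ²`, hence `Θ₁ = e^{y}`, `η = e^{y} − 1 ≤ 2y`, `y = 2a + 4Cλ² + 2E_kλ = O(λ)`.

* `channel_window`, `pair_from_windows`, `budgets`, `oneSite_large`, `side_conditions` (pure real), ★★ `liftPositionForL_of_block`, ★ `stubR8_liftPosition_of_block`, ★★★ `dressedRitz_of_block_parts`
  (`∀k, LiftPositionForL (TransplantBasisLR k)` from the block texts + statics of every transplant basis).

CONSEQUENCE (r9 candidate of the LEAD, not a registry event): `DressedRitz ⟸ (∀k StaticsForL) ∧ (∀k BlockPositionForL) ∧ (∀k BlockLeakageForL)` on `TransplantBasisLR`, by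
`operatorPlateauAt_of_partsForL` + `leakageForL_of_blockLeakageForL` + this file — all three remaining texts block-aligned and L-free (`dressedRitz_of_block_parts`).

HONEST FRAMING: quantifier bookkeeping + one-site level arithmetic on the CONDITIONAL femto rung R2b1; every block text is an OPEN renormalisation-group estimate (not in print);
nothing here bears on infinite volume, the continuum limit or the Clay gap.  References: M. Lüscher, NPB 219 (1983) 233 [cite: Luscher1983, §2–§3]; Lüscher–Wolff [cite: LuscherWolff1990].
-/

set_option autoImplicit false

noncomputable section

open MeasureTheory Filter Topology Real Finset
open Literature.MathematicalPhysics.QuantumFieldTheory (GaugeConfig Site gaugeTransform)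
open Literature.MathematicalPhysics.QuantumLattice
open Literature.Analysis.OperatorTheory.YMMatrixModel
open scoped BigOperators

namespace Summit.QuantumFields.YangMills.Theorems.FemtoTransferGap.PolyakovLift

open Summit.QuantumFields.YangMills.Theorems.FemtoTransferGap

/-! ## §1 Pure real: the window of one block quotient -/

/-- ★ CHANNEL WINDOW.  One-site levels `μ_j = ν e^{−ε_j x ± Cx²}` (`j` = the channel's level and `0`), `L·x = λ`, `0 ≤ x ≤ λ`, block position
`X·μ₀^L ≤ e^{a}(μ_jλ₀)^L` and `(μ_jλ₀)^L ≤ e^{a}X·μ₀^L` (`X` = block quotient): then `X ≤ e^{a + 2Cλ² + ε₀λ}·λ₀^L` and `λ₀^L ≤ e^{a + 2Cλ² + ε_jλ}·X`. [cite: Luscher1983, §2] -/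
theorem channel_window {X m0 μ l0 ν x lam Cc a E0 Ej : ℝ} {L : ℕ} (hν : 0 < ν) (hm0 : 0 < m0) (hμ : 0 < μ) (hl0 : 0 ≤ l0)
    (hx0 : 0 ≤ x) (hxlam : x ≤ lam) (hLx : (L : ℝ) * x = lam) (hCc : 0 ≤ Cc) (hE0 : 0 ≤ E0) (hEj : 0 ≤ Ej)
    (hm0lo : ν * Real.exp (-(E0 * x) - Cc * x ^ 2) ≤ m0) (hm0hi : m0 ≤ ν * Real.exp (-(E0 * x) + Cc * x ^ 2))
    (hμlo : ν * Real.exp (-(Ej * x) - Cc * x ^ 2) ≤ μ) (hμhi : μ ≤ ν * Real.exp (-(Ej * x) + Cc * x ^ 2))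
    (hB5up : X * m0 ^ L ≤ Real.exp a * (μ * l0) ^ L) (hB5lo : (μ * l0) ^ L ≤ Real.exp a * (X * m0 ^ L)) :
    X ≤ Real.exp (a + 2 * Cc * lam ^ 2 + E0 * lam) * l0 ^ L ∧ l0 ^ L ≤ Real.exp (a + 2 * Cc * lam ^ 2 + Ej * lam) * X := by
  have hm0L : 0 < m0 ^ L := pow_pos hm0 L
  -- ratio bounds: μ/m0 ≤ e^{(E0−Ej)x + 2Cx²} ≤ e^{E0 x + 2C x²};  m0/μ ≤ e^{(Ej − E0)x + 2Cx²} ≤ e^{Ej x + 2Cx²}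
  have hr1 : μ ≤ Real.exp (E0 * x + 2 * Cc * x ^ 2) * m0 := by
    calc μ ≤ ν * Real.exp (-(Ej * x) + Cc * x ^ 2) := hμhi
      _ ≤ ν * Real.exp (-(E0 * x) - Cc * x ^ 2) * Real.exp (E0 * x + 2 * Cc * x ^ 2) := by
          rw [mul_assoc, ← Real.exp_add]
          exact mul_le_mul_of_nonneg_left (Real.exp_le_exp.2 (by nlinarith [mul_nonneg hEj hx0])) hν.le
      _ ≤ m0 * Real.exp (E0 * x + 2 * Cc * x ^ 2) := mul_le_mul_of_nonneg_right hm0lo (Real.exp_pos _).le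
      _ = _ := by ring
  have hr2 : m0 ≤ Real.exp (Ej * x + 2 * Cc * x ^ 2) * μ := by
    calc m0 ≤ ν * Real.exp (-(E0 * x) + Cc * x ^ 2) := hm0hi
      _ ≤ ν * Real.exp (-(Ej * x) - Cc * x ^ 2) * Real.exp (Ej * x + 2 * Cc * x ^ 2) := by
          rw [mul_assoc, ← Real.exp_add]
          exact mul_le_mul_of_nonneg_left (Real.exp_le_exp.2 (by nlinarith [mul_nonneg hE0 hx0])) hν.le
      _ ≤ μ * Real.exp (Ej * x + 2 * Cc * x ^ 2) := mul_le_mul_of_nonneg_right hμlo (Real.exp_pos _).le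
      _ = _ := by ring
  -- powers: e^{L(E x + 2C x²)} ≤ e^{E lam + 2C lam²}
  have hpow : ∀ E : ℝ, 0 ≤ E → Real.exp (E * x + 2 * Cc * x ^ 2) ^ L ≤ Real.exp (2 * Cc * lam ^ 2 + E * lam) := by
    intro E hE
    rw [← Real.exp_nat_mul]
    apply Real.exp_le_exp.2
    have h1 : (L : ℝ) * (E * x) = E * lam := by rw [← hLx]; ring
    have h2 : (L : ℝ) * (2 * Cc * x ^ 2) = 2 * Cc * lam * x := by rw [← hLx]; ring
    have h3 : 2 * Cc * lam * x ≤ 2 * Cc * lam ^ 2 := by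
      have hlam0 : 0 ≤ lam := le_trans hx0 hxlam
      nlinarith [mul_le_mul_of_nonneg_left hxlam (mul_nonneg (mul_nonneg (by norm_num : (0:ℝ) ≤ 2) hCc) hlam0)]
    rw [mul_add, h1, h2]; linarith
  constructor
  · -- X ≤ e^a (μ l0)^L / m0^L = e^a l0^L (μ/m0)^L ≤ e^a l0^L e^{L(...)} ≤ ...
    have h1 : X ≤ Real.exp a * (μ * l0) ^ L / m0 ^ L := by rw [le_div_iff₀ hm0L]; exact hB5up
    have h2 : (μ * l0) ^ L ≤ (Real.exp (E0 * x + 2 * Cc * x ^ 2) * m0 * l0) ^ L :=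
      pow_le_pow_left₀ (mul_nonneg hμ.le hl0) (mul_le_mul_of_nonneg_right hr1 hl0) L
    calc X ≤ Real.exp a * (μ * l0) ^ L / m0 ^ L := h1
      _ ≤ Real.exp a * (Real.exp (E0 * x + 2 * Cc * x ^ 2) * m0 * l0) ^ L / m0 ^ L :=
          div_le_div_of_nonneg_right (mul_le_mul_of_nonneg_left h2 (Real.exp_pos a).le) hm0L.le
      _ = Real.exp a * Real.exp (E0 * x + 2 * Cc * x ^ 2) ^ L * l0 ^ L := by
          rw [mul_pow, mul_pow]; field_simp
      _ ≤ Real.exp a * Real.exp (2 * Cc * lam ^ 2 + E0 * lam) * l0 ^ L :=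
          mul_le_mul_of_nonneg_right (mul_le_mul_of_nonneg_left (hpow E0 hE0) (Real.exp_pos a).le) (pow_nonneg hl0 L)
      _ = Real.exp (a + 2 * Cc * lam ^ 2 + E0 * lam) * l0 ^ L := by simp only [Real.exp_add]; ring
  · -- l0^L m0^L... (μ l0)^L ≤ e^a X m0^L and m0 ≤ e^{..} μ ⇒ (m0 l0)^L ≤ e^{L..}(μ l0)^L ≤ e^{L..} e^a X m0^L
    have h2 : (m0 * l0) ^ L ≤ (Real.exp (Ej * x + 2 * Cc * x ^ 2) * μ * l0) ^ L :=
      pow_le_pow_left₀ (mul_nonneg hm0.le hl0) (mul_le_mul_of_nonneg_right hr2 hl0) L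
    have h3 : (m0 * l0) ^ L ≤ Real.exp (2 * Cc * lam ^ 2 + Ej * lam) * (Real.exp a * (X * m0 ^ L)) := by
      calc (m0 * l0) ^ L ≤ (Real.exp (Ej * x + 2 * Cc * x ^ 2) * μ * l0) ^ L := h2
        _ = Real.exp (Ej * x + 2 * Cc * x ^ 2) ^ L * (μ * l0) ^ L := by rw [← mul_pow]; ring
        _ ≤ Real.exp (2 * Cc * lam ^ 2 + Ej * lam) * (Real.exp a * (X * m0 ^ L)) :=
            mul_le_mul (hpow Ej hEj) hB5lo (pow_nonneg (mul_nonneg hμ.le hl0) L) (Real.exp_pos _).le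
    rw [mul_pow] at h3
    -- divide by m0^L
    have h4 : l0 ^ L * m0 ^ L ≤ (Real.exp (a + 2 * Cc * lam ^ 2 + Ej * lam) * X) * m0 ^ L := by
      calc l0 ^ L * m0 ^ L = m0 ^ L * l0 ^ L := by ring
        _ ≤ Real.exp (2 * Cc * lam ^ 2 + Ej * lam) * (Real.exp a * (X * m0 ^ L)) := h3
        _ = (Real.exp (a + 2 * Cc * lam ^ 2 + Ej * lam) * X) * m0 ^ L := by
            simp only [Real.exp_add]; ring
    exact le_of_mul_le_mul_right h4 hm0L

/-- ★ PAIR FROM WINDOWS (pure real): if `X ≤ e^{y₁}T`, `T ≤ e^{y₂}X`, `X' ≤ e^{y₁'}T`, `T ≤ e^{y₂'}X'` with all `y`'s `≤ y/2`, `0 ≤ y`, `X, X', T > 0`, then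
`X ≤ e^{y}X'`, `|X − X'| ≤ (e^{y} − 1)X'`, and `T ≤ e^{y}X`. [folklore] -/
theorem pair_from_windows {X X' T y y₁ y₂ y₁' y₂' : ℝ} (hX : 0 < X) (hX' : 0 < X') (hy : 0 ≤ y)
    (h1 : X ≤ Real.exp y₁ * T) (h2 : T ≤ Real.exp y₂ * X) (h1' : X' ≤ Real.exp y₁' * T) (h2' : T ≤ Real.exp y₂' * X')
    (hy1 : y₁ ≤ y / 2) (hy2 : y₂ ≤ y / 2) (hy1' : y₁' ≤ y / 2) (hy2' : y₂' ≤ y / 2) :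
    X ≤ Real.exp y * X' ∧ |X - X'| ≤ (Real.exp y - 1) * X' ∧ T ≤ Real.exp y * X := by
  have hE : ∀ s t : ℝ, Real.exp s * Real.exp t = Real.exp (s + t) := fun s t => (Real.exp_add s t).symm
  have hup : X ≤ Real.exp y * X' := by
    calc X ≤ Real.exp y₁ * T := h1
      _ ≤ Real.exp y₁ * (Real.exp y₂' * X') := mul_le_mul_of_nonneg_left h2' (Real.exp_pos _).le
      _ = Real.exp (y₁ + y₂') * X' := by rw [← mul_assoc, hE]
      _ ≤ Real.exp y * X' := mul_le_mul_of_nonneg_right (Real.exp_le_exp.2 (by linarith)) hX'.le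
  have hup' : X' ≤ Real.exp y * X := by
    calc X' ≤ Real.exp y₁' * T := h1'
      _ ≤ Real.exp y₁' * (Real.exp y₂ * X) := mul_le_mul_of_nonneg_left h2 (Real.exp_pos _).le
      _ = Real.exp (y₁' + y₂) * X := by rw [← mul_assoc, hE]
      _ ≤ Real.exp y * X := mul_le_mul_of_nonneg_right (Real.exp_le_exp.2 (by linarith)) hX.le
  have hTX : T ≤ Real.exp y * X := le_trans h2 (mul_le_mul_of_nonneg_right (Real.exp_le_exp.2 (by linarith)) hX.le)
  have hey : 1 ≤ Real.exp y := Real.one_le_exp hy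
  refine ⟨hup, ?_, hTX⟩
  rw [abs_le]
  constructor
  · -- X − X' ≥ −(e^y − 1) X' ⟸ X ≥ e^{−y} X' ≥ (2 − e^y) X' ... use X' ≤ e^y X ⇒ X ≥ X'/e^y ≥ X'(2 − e^y)?  (1/e^y ≥ 2 − e^y since (e^y −1)² ≥ 0)
    have hinv : X' ≤ Real.exp y * X := hup'
    have hq : X' * 1 ≤ Real.exp y * X := by linarith
    -- (e^y − 1) X' + X − X' ≥ 0  ⟸  e^y X' − 2X' + X ≥ 0 ⟸ e^y·(e^y X' − 2 X' + X) = (e^y X' − ... use e^y X ≥ X' and (e^y − 1)² X' ≥ 0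
    nlinarith [mul_nonneg (sq_nonneg (Real.exp y - 1)) hX'.le, hinv, hey, hX.le]
  · linarith

/-! ## §2 Pure real: the budgets -/

/-- ★ BUDGETS (pure real): with `0 < λ ≤ 1`, `a = E = C_Bλ²`, `δ = C_δλ³`, `s = C_Sλ`, `0 ≤ η ≤ 2c_yλ`, `Θ₁ ≥ 1` and
`C = (C_B + 15C_δ) + (2Θ₁C_B + 2Θ₁(2c_y+15C_δ)C_S + (32(2Θ₁)⁴+8(2Θ₁))C_δ + 128(2Θ₁)²(2c_y+15C_δ)²)`:
`a + 15δ ≤ Cλ²` and `2Θ₁E + 2Θ₁(η+15δ)s + ((32(2Θ₁)⁴+8(2Θ₁))δ + 128(2Θ₁)²(η+15δ)²) ≤ Cλ²`. [folklore] -/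
theorem budgets {lam CB Cδ CS cy Θ₁ η : ℝ} (hlam : 0 < lam) (hlam1 : lam ≤ 1) (hCB : 0 ≤ CB) (hCδ : 0 ≤ Cδ) (hCS : 0 ≤ CS) (hcy : 0 ≤ cy)
    (hΘ₁ : 1 ≤ Θ₁) (hη0 : 0 ≤ η) (hη : η ≤ 2 * cy * lam) :
    let C := (CB + 15 * Cδ) + (2 * Θ₁ * CB + 2 * Θ₁ * (2 * cy + 15 * Cδ) * CS + (32 * (2 * Θ₁) ^ 4 + 8 * (2 * Θ₁)) * Cδ +
      128 * (2 * Θ₁) ^ 2 * (2 * cy + 15 * Cδ) ^ 2)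
    CB * lam ^ 2 + 15 * (Cδ * lam ^ 3) ≤ C * lam ^ 2 ∧
    2 * Θ₁ * (CB * lam ^ 2) + 2 * Θ₁ * (η + 15 * (Cδ * lam ^ 3)) * (CS * lam) +
        ((32 * (2 * Θ₁) ^ 4 + 8 * (2 * Θ₁)) * (Cδ * lam ^ 3) + 128 * (2 * Θ₁) ^ 2 * (η + 15 * (Cδ * lam ^ 3)) ^ 2) ≤ C * lam ^ 2 := by
  intro C
  have hΘ0 : 0 ≤ Θ₁ := by linarith
  have hl2 : 0 ≤ lam ^ 2 := sq_nonneg _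
  have hl3 : lam ^ 3 ≤ lam ^ 2 := by nlinarith
  have hδ2 : Cδ * lam ^ 3 ≤ Cδ * lam ^ 2 := mul_le_mul_of_nonneg_left hl3 hCδ
  -- η + 15δ ≤ (2cy + 15Cδ) λ
  have hηδ : η + 15 * (Cδ * lam ^ 3) ≤ (2 * cy + 15 * Cδ) * lam := by nlinarith
  have hηδ0 : 0 ≤ η + 15 * (Cδ * lam ^ 3) := by positivity
  have hK0 : 0 ≤ (2 * cy + 15 * Cδ) * lam := by positivity
  set R := 2 * Θ₁ * CB + 2 * Θ₁ * (2 * cy + 15 * Cδ) * CS + (32 * (2 * Θ₁) ^ 4 + 8 * (2 * Θ₁)) * Cδ +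
      128 * (2 * Θ₁) ^ 2 * (2 * cy + 15 * Cδ) ^ 2 with hR
  have hR0 : 0 ≤ R := by positivity
  have hC : C = (CB + 15 * Cδ) + R := rfl
  constructor
  · rw [hC]; nlinarith [hδ2]
  · -- term by term
    have t2 : 2 * Θ₁ * (η + 15 * (Cδ * lam ^ 3)) * (CS * lam) ≤ 2 * Θ₁ * (2 * cy + 15 * Cδ) * CS * lam ^ 2 := by
      have := mul_le_mul hηδ (le_refl (CS * lam)) (by positivity) hK0
      have h2 : 0 ≤ 2 * Θ₁ := by positivity
      calc 2 * Θ₁ * (η + 15 * (Cδ * lam ^ 3)) * (CS * lam) = 2 * Θ₁ * ((η + 15 * (Cδ * lam ^ 3)) * (CS * lam)) := by ring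
        _ ≤ 2 * Θ₁ * ((2 * cy + 15 * Cδ) * lam * (CS * lam)) := mul_le_mul_of_nonneg_left this h2
        _ = 2 * Θ₁ * (2 * cy + 15 * Cδ) * CS * lam ^ 2 := by ring
    have t3 : (32 * (2 * Θ₁) ^ 4 + 8 * (2 * Θ₁)) * (Cδ * lam ^ 3) ≤ (32 * (2 * Θ₁) ^ 4 + 8 * (2 * Θ₁)) * Cδ * lam ^ 2 := by
      have := mul_le_mul_of_nonneg_left hδ2 (by positivity : (0:ℝ) ≤ 32 * (2 * Θ₁) ^ 4 + 8 * (2 * Θ₁)); linarith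
    have t4 : 128 * (2 * Θ₁) ^ 2 * (η + 15 * (Cδ * lam ^ 3)) ^ 2 ≤ 128 * (2 * Θ₁) ^ 2 * (2 * cy + 15 * Cδ) ^ 2 * lam ^ 2 := by
      have hsq : (η + 15 * (Cδ * lam ^ 3)) ^ 2 ≤ ((2 * cy + 15 * Cδ) * lam) ^ 2 := pow_le_pow_left₀ hηδ0 hηδ 2
      have := mul_le_mul_of_nonneg_left hsq (by positivity : (0:ℝ) ≤ 128 * (2 * Θ₁) ^ 2)
      calc _ ≤ 128 * (2 * Θ₁) ^ 2 * ((2 * cy + 15 * Cδ) * lam) ^ 2 := this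
        _ = _ := by ring
    rw [hC]
    have hfirst : 0 ≤ (CB + 15 * Cδ) * lam ^ 2 := by positivity
    nlinarith [t2, t3, t4, hfirst]

/-! ## §3 Small real lemmas for the shell -/

/-- The one-site coupling is large on the window: `Λ ≤ 1`, `L ≥ 4B₁`, `L ≥ 1` ⟹ `B₁ ≤ 2L³/Λ³`. [folklore] -/
theorem oneSite_large {Λ Lr B₁ : ℝ} (hΛ : 0 < Λ) (hΛ1 : Λ ≤ 1) (hL1 : 1 ≤ Lr) (hL4 : 4 * B₁ ≤ Lr) (hB₁ : 0 ≤ B₁) :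
    B₁ ≤ 2 * Lr ^ 3 / Λ ^ 3 := by
  rw [le_div_iff₀ (pow_pos hΛ 3)]
  have hΛ3 : Λ ^ 3 ≤ 1 := pow_le_one₀ hΛ.le hΛ1
  have hL3 : Lr ≤ Lr ^ 3 := by
    have h1 : 1 ≤ Lr ^ 2 := one_le_pow₀ hL1
    nlinarith
  calc B₁ * Λ ^ 3 ≤ B₁ * 1 := mul_le_mul_of_nonneg_left hΛ3 hB₁
    _ ≤ Lr / 4 := by linarith
    _ ≤ 2 * Lr ^ 3 := by linarith

/-- SIDE CONDITIONS from the channel windows (pure real): windows `X_i ≤ e^{c + E₀Λ}T`, `T ≤ e^{c + E_iΛ}X_i` with `c + E₀Λ, c + E_iΛ ≤ y/2`, `0 ≤ y`, `T > 0`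
give comparability `X_i ≤ e^{y}X_l`, mismatch `|X_i − X_l| ≤ (e^{y}−1)X_l` and top `T ≤ e^{y}X_i`. [folklore] -/
theorem side_conditions {k : ℕ} (X : Fin k → ℝ) (E : Fin k → ℝ) {T y c E₀ Λ : ℝ} (hT : 0 < T) (hy : 0 ≤ y)
    (hw : ∀ i, X i ≤ Real.exp (c + E₀ * Λ) * T ∧ T ≤ Real.exp (c + E i * Λ) * X i)
    (h0 : c + E₀ * Λ ≤ y / 2) (hi : ∀ i, c + E i * Λ ≤ y / 2) (i l : Fin k) :
    X i ≤ Real.exp y * X l ∧ |X i - X l| ≤ (Real.exp y - 1) * X l ∧ T ≤ Real.exp y * X i := by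
  have hXpos : ∀ j, 0 < X j := fun j => (mul_pos_iff_of_pos_left (Real.exp_pos _)).1 (lt_of_lt_of_le hT (hw j).2)
  exact pair_from_windows (hXpos i) (hXpos l) hy (hw i).1 (hw i).2 (hw l).1 (hw l).2 h0 (hi i) h0 (hi l)

/-- `y = 2(C_BΛ² + 2CΛ² + E_kΛ) ≤ c_y·Λ`, `c_y = 2C_B + 4C + 2E_k`, for `0 ≤ Λ ≤ 1`. [folklore] -/
theorem y_le_cy {CB Cc Ek Λ : ℝ} (hCB : 0 ≤ CB) (hCc : 0 ≤ Cc) (hΛ0 : 0 ≤ Λ) (hΛ1 : Λ ≤ 1) :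
    2 * (CB * Λ ^ 2 + 2 * Cc * Λ ^ 2 + Ek * Λ) ≤ (2 * CB + 4 * Cc + 2 * Ek) * Λ := by
  have : Λ ^ 2 ≤ Λ := by nlinarith
  nlinarith [mul_le_mul_of_nonneg_left this hCB, mul_le_mul_of_nonneg_left this hCc]

/-! ## §4 ★★ The `…ForL` assembly -/
set_option maxHeartbeats 400000 in
/-- ★★ **POSITION FROM BLOCK DATA**: `BasisPhysL P → BlockPositionForL P → BlockLeakageForL P → StaticsForL P → LiftPositionForL P`.  The ∃-basis of BLOCK POSITION is
the witness; its block defects (BLOCK LEAKAGE, ∀-basis) and statics (∀-basis) hold for it; the side conditions of `dynamicCoreClauses_of_block` come from the closed crux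
ONE (`PScal.exists_uniform_twoSided` at `B = oneSiteCoupling β L`, `bareLambda B = λ/L`) through `channel_window` ∕ `side_conditions`, with `Θ₁ = e`, `η = e^{y}−1 ≤ 2y`,
`y = 2(C_Bλ² + 2Cλ² + E_kλ) ≤ 1` on the shrunk window. [cite: Luscher1983, §2–§3] [cite: LuscherWolff1990] -/
theorem liftPositionForL_of_block {k : ℕ} {P : ℕ → ℝ → (Fin k → (GaugeConfig 3 1 SU2 → ℝ)) → Prop} (hP : BasisPhysL P)
    (hBP : BlockPositionForL P) (hBL : BlockLeakageForL P) (hS : StaticsForL P) : LiftPositionForL P := by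
  obtain ⟨CB, lB, hCB, hlB, hBPk⟩ := hBP
  obtain ⟨Cδ, lδ, hCδ, hlδ, hBLk⟩ := hBL
  obtain ⟨CS, lS, hCS, hlS, hSk⟩ := hS
  obtain ⟨Cc, B₁, hCc, hB₁, htwo⟩ := PScal.exists_uniform_twoSided k
  -- a uniform bound for the one-site levels involved
  have hEle : ∀ j, j ≤ k + 1 → physLevel (j + 1) ≤ ∑ j ∈ Finset.range (k + 2), physLevel (j + 1) := fun j hj =>
    Finset.single_le_sum (f := fun j => physLevel (j + 1)) (fun i _ => physLevel_nonneg (by omega)) (Finset.mem_range.2 (by omega))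
  obtain ⟨Ek, hEk0, hEle⟩ : ∃ Ek : ℝ, 0 ≤ Ek ∧ ∀ j, j ≤ k + 1 → physLevel (j + 1) ≤ Ek :=
    ⟨_, le_trans (physLevel_nonneg (by omega)) (hEle 0 (by omega)), hEle⟩
  have hcy0 : 0 ≤ 2 * CB + 4 * Cc + 2 * Ek := by positivity
  have hΘ₁1 : (1 : ℝ) ≤ Real.exp 1 := Real.one_le_exp zero_le_one
  refine ⟨(CB + 15 * Cδ) + (2 * Real.exp 1 * CB + 2 * Real.exp 1 * (2 * (2 * CB + 4 * Cc + 2 * Ek) + 15 * Cδ) * CS +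
      (32 * (2 * Real.exp 1) ^ 4 + 8 * (2 * Real.exp 1)) * Cδ + 128 * (2 * Real.exp 1) ^ 2 * (2 * (2 * CB + 4 * Cc + 2 * Ek) + 15 * Cδ) ^ 2),
    min (min lB (min lδ lS)) (min 1 (min (1 / (256 * Cδ + 1)) (1 / (4 * (2 * CB + 4 * Cc + 2 * Ek) + 2)))), by positivity,
    lt_min (lt_min hlB (lt_min hlδ hlS)) (lt_min one_pos (lt_min (by positivity) (by positivity))), fun lam hlam hle => ?_⟩
  have hleB : lam ≤ lB := hle.trans ((min_le_left _ _).trans (min_le_left _ _))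
  have hleδ : lam ≤ lδ := hle.trans ((min_le_left _ _).trans ((min_le_right _ _).trans (min_le_left _ _)))
  have hleS : lam ≤ lS := hle.trans ((min_le_left _ _).trans ((min_le_right _ _).trans (min_le_right _ _)))
  have hle1 : lam ≤ 1 := hle.trans ((min_le_right _ _).trans (min_le_left _ _))
  have hle256 : lam ≤ 1 / (256 * Cδ + 1) := hle.trans ((min_le_right _ _).trans ((min_le_right _ _).trans (min_le_left _ _)))
  have hlecy : lam ≤ 1 / (4 * (2 * CB + 4 * Cc + 2 * Ek) + 2) := hle.trans ((min_le_right _ _).trans ((min_le_right _ _).trans (min_le_right _ _)))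
  obtain ⟨LB, hLB⟩ := hBPk lam hlam hleB
  obtain ⟨Lδ, hLδ⟩ := hBLk lam hlam hleδ
  obtain ⟨LS, hLS⟩ := hSk lam hlam hleS
  refine ⟨max (max LB (max Lδ LS)) (Nat.ceil (4 * B₁)), fun L _ hL β hW φ hφ => ?_⟩
  have hLB' : LB ≤ L := le_trans (le_trans (le_max_left _ _) (le_max_left _ _)) hL
  have hLδ' : Lδ ≤ L := le_trans (le_trans ((le_max_left _ _).trans (le_max_right _ _)) (le_max_left _ _)) hL
  have hLS' : LS ≤ L := le_trans (le_trans ((le_max_right _ _).trans (le_max_right _ _)) (le_max_left _ _)) hL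
  have hL4 : 4 * B₁ ≤ (L : ℝ) := le_trans (Nat.le_ceil _) (by exact_mod_cast le_trans (le_max_right _ _) hL)
  -- window facts
  have hβ : 0 < β := zero_lt_one.trans_le hW.1
  have hΛpos : 0 < luscherLambda β L := luscherLambda_pos_of_window hlam hW
  have hlamhalf : lam ≤ 1 / 2 := le_trans hlecy (div_le_div_of_nonneg_left zero_le_one (by norm_num) (by linarith))
  have hΛ1 : luscherLambda β L ≤ 1 := by linarith [hW.2.2]
  have hL1 : (1 : ℝ) ≤ L := by exact_mod_cast (NeZero.one_le : 1 ≤ L)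
  have hBpos : 0 < oneSiteCoupling β L := by unfold oneSiteCoupling; positivity
  have hBge : B₁ ≤ oneSiteCoupling β L := oneSite_large hΛpos hΛ1 hL1 hL4 (by linarith)
  have hx : bareLambda (oneSiteCoupling β L) = luscherLambda β L / L := bareLambda_oneSiteCoupling hΛpos
  have hx0 : 0 ≤ bareLambda (oneSiteCoupling β L) := by rw [hx]; positivity
  have hxΛ : bareLambda (oneSiteCoupling β L) ≤ luscherLambda β L := by rw [hx]; exact div_le_self hΛpos.le hL1
  have hLx : ((dressSteps L : ℕ) : ℝ) * bareLambda (oneSiteCoupling β L) = luscherLambda β L := by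
    rw [hx, show ((dressSteps L : ℕ) : ℝ) = (L : ℝ) from rfl]; field_simp
  have hν : 0 < linkC (oneSiteCoupling β L) ^ 3 := pow_pos (linkC_pos hBpos.le) 3
  -- the basis
  obtain ⟨g, hg, hB5, hB6⟩ := hLB L hLB' β hW φ hφ
  have hstat := hLS L hLS' β hW φ hφ g hg
  have hleak := fun i => hLδ L hLδ' β hW φ hφ g hg i
  have hv : ∀ i, IsPhys (liftVec β φ (g i)) := fun i => isPhys_liftVec β hφ.1 (hP _ _ _ hg i)
  -- δ, y, η
  have hδ1 : Cδ * luscherLambda β L ^ 3 ≤ 1 / 32 := C_mul_cube_le hCδ hlam hle1 hle256 hW.2.1 hW.2.2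
  have hy0 : 0 ≤ 2 * (CB * luscherLambda β L ^ 2 + 2 * Cc * luscherLambda β L ^ 2 + Ek * luscherLambda β L) := by positivity
  have hycy := y_le_cy (Ek := Ek) hCB hCc hΛpos.le hΛ1
  have hy1 : 2 * (CB * luscherLambda β L ^ 2 + 2 * Cc * luscherLambda β L ^ 2 + Ek * luscherLambda β L) ≤ 1 := by
    have h1 : (2 * CB + 4 * Cc + 2 * Ek) * luscherLambda β L ≤ (2 * CB + 4 * Cc + 2 * Ek) * (2 * lam) := mul_le_mul_of_nonneg_left hW.2.2 hcy0
    have h2 : (2 * CB + 4 * Cc + 2 * Ek) * (2 * lam) ≤ 1 := by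
      have := hlecy; rw [le_div_iff₀ (by positivity)] at this; linarith
    linarith
  have heΘ : Real.exp (2 * (CB * luscherLambda β L ^ 2 + 2 * Cc * luscherLambda β L ^ 2 + Ek * luscherLambda β L)) ≤ Real.exp 1 := Real.exp_le_exp.2 hy1
  have hexp2 : ∀ y : ℝ, 0 ≤ y → y ≤ 1 → Real.exp y - 1 ≤ 2 * y := fun y h0 h1 => by
    -- (the same one-liner is `Literature.NumberTheory.Sieve.SquarefreeSums.exp_sub_one_le_two_mul`; inlined to keep the import cone small)
    have h := Real.abs_exp_sub_one_sub_id_le (x := y) (by rw [abs_of_nonneg h0]; exact h1)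
    have := (abs_le.1 h).2
    nlinarith
  have hη : Real.exp (2 * (CB * luscherLambda β L ^ 2 + 2 * Cc * luscherLambda β L ^ 2 + Ek * luscherLambda β L)) - 1 ≤
      2 * (2 * CB + 4 * Cc + 2 * Ek) * luscherLambda β L := le_trans (hexp2 _ hy0 hy1) (by linarith)
  have hη0 : 0 ≤ Real.exp (2 * (CB * luscherLambda β L ^ 2 + 2 * Cc * luscherLambda β L ^ 2 + Ek * luscherLambda β L)) - 1 := by
    linarith [Real.one_le_exp hy0]
  have hl0 : 0 ≤ levelValue su2Rep L β 0 := levelValue_su2Rep_nonneg L hβ.le 0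
  have hl0pos : 0 < levelValue su2Rep L β 0 ^ dressSteps L := pow_pos (levelValue_su2Rep_pos hβ 0) _
  -- the windows, channel by channel
  have hwin : ∀ i : Fin k,
      l2 (dressedLiftFamily β φ g i) ((transferApply β)^[dressSteps L] (dressedLiftFamily β φ g i)) / l2 (dressedLiftFamily β φ g i) (dressedLiftFamily β φ g i) ≤
          Real.exp (CB * luscherLambda β L ^ 2 + 2 * Cc * luscherLambda β L ^ 2 + physLevel 1 * luscherLambda β L) * levelValue su2Rep L β 0 ^ dressSteps L ∧
        levelValue su2Rep L β 0 ^ dressSteps L ≤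
          Real.exp (CB * luscherLambda β L ^ 2 + 2 * Cc * luscherLambda β L ^ 2 + physLevel ((i : ℕ) + 1 + 1) * luscherLambda β L) *
            (l2 (dressedLiftFamily β φ g i) ((transferApply β)^[dressSteps L] (dressedLiftFamily β φ g i)) /
              l2 (dressedLiftFamily β φ g i) (dressedLiftFamily β φ g i)) := by
    intro i
    have hn := hstat.1 i
    obtain ⟨h0lo, h0hi⟩ := htwo _ hBge 0 (Nat.zero_le k)
    obtain ⟨hjlo, hjhi⟩ := htwo _ hBge ((i : ℕ) + 1) (by omega)
    have hm0 : 0 < levelValue su2Rep 1 (oneSiteCoupling β L) 0 := levelValue_su2Rep_pos (L := 1) hBpos 0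
    have hμ : 0 < levelValue su2Rep 1 (oneSiteCoupling β L) ((i : ℕ) + 1) := levelValue_su2Rep_pos (L := 1) hBpos _
    obtain ⟨h5a, h5b⟩ := hB5 i
    exact channel_window (L := dressSteps L) hν hm0 hμ hl0 hx0 hxΛ hLx hCc (physLevel_nonneg (by omega)) (physLevel_nonneg (by omega))
      h0lo h0hi hjlo hjhi
      (by rw [div_mul_eq_mul_div, div_le_iff₀ hn]; exact h5a)
      (by rw [div_mul_eq_mul_div, mul_div_assoc', le_div_iff₀ hn]; exact h5b)
  -- side conditions and budgets
  have hside := side_conditions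
    (fun i : Fin k => l2 (dressedLiftFamily β φ g i) ((transferApply β)^[dressSteps L] (dressedLiftFamily β φ g i)) / l2 (dressedLiftFamily β φ g i) (dressedLiftFamily β φ g i))
    (fun i : Fin k => physLevel ((i : ℕ) + 1 + 1)) (c := CB * luscherLambda β L ^ 2 + 2 * Cc * luscherLambda β L ^ 2) (E₀ := physLevel 1)
    (y := 2 * (CB * luscherLambda β L ^ 2 + 2 * Cc * luscherLambda β L ^ 2 + Ek * luscherLambda β L)) hl0pos hy0 hwin
    (by nlinarith [mul_le_mul_of_nonneg_right (hEle 0 (by omega)) hΛpos.le])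
    (fun i => by nlinarith [mul_le_mul_of_nonneg_right (hEle ((i : ℕ) + 1) (by omega)) hΛpos.le])
  obtain ⟨hC5, hC6⟩ := budgets (CB := CB) (Cδ := Cδ) (CS := CS) (cy := 2 * CB + 4 * Cc + 2 * Ek) (Θ₁ := Real.exp 1) hΛpos hΛ1 hCB hCδ hCS hcy0 hΘ₁1 hη0 hη
  refine ⟨g, hg, ?_⟩
  exact dynamicCoreClauses_of_block (δ := Cδ * luscherLambda β L ^ 3) (a := CB * luscherLambda β L ^ 2) (E := CB * luscherLambda β L ^ 2)
    (s := CS * luscherLambda β L) (Θ₁ := Real.exp 1)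
    (η := Real.exp (2 * (CB * luscherLambda β L ^ 2 + 2 * Cc * luscherLambda β L ^ 2 + Ek * luscherLambda β L)) - 1)
    hβ hv (by positivity) hδ1 (by positivity) (by positivity) hΘ₁1 hη0 hBpos hstat.1
    (fun i => (hleak i).1) (fun i => (hleak i).2) hB5 hB6 hstat.2
    (fun i l => le_trans (hside i l).1 (mul_le_mul_of_nonneg_right heΘ (le_of_lt ((mul_pos_iff_of_pos_left (Real.exp_pos _)).1 (lt_of_lt_of_le hl0pos (hwin l).2)))))
    (fun i l => (hside i l).2.1)
    (fun i => le_trans (hside i i).2.2 (mul_le_mul_of_nonneg_right heΘ (le_of_lt ((mul_pos_iff_of_pos_left (Real.exp_pos _)).1 (lt_of_lt_of_le hl0pos (hwin i).2)))))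
    hC5 hC6

/-- ★ r8/r9 BY NAME: `∀k, LiftPositionForL (TransplantBasisLR k)` from the block texts and statics of every transplant basis. [cite: Luscher1983, §3] -/
theorem stubR8_liftPosition_of_block (hBP : ∀ k, BlockPositionForL (TransplantBasisLR k)) (hBL : ∀ k, BlockLeakageForL (TransplantBasisLR k))
    (hS : ∀ k, StaticsForL (TransplantBasisLR k)) : ∀ k : ℕ, LiftPositionForL (TransplantBasisLR k) :=
  fun k => liftPositionForL_of_block (basisPhysL_transplantBasisLR k) (hBP k) (hBL k) (hS k)

/-- ★★★ r9 CANDIDATE COMPOSITION: **`(∀k Statics) ∧ (∀k BlockPosition) ∧ (∀k BlockLeakage) → DressedRitz`** on the transplant bases — all three texts block-aligned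
and L-free (door p520668 via `operatorPlateauAt_of_partsForL`). [cite: Luscher1983, §3] [cite: LuscherWolff1990] -/
theorem dressedRitz_of_block_parts (hS : ∀ k, StaticsForL (TransplantBasisLR k)) (hBP : ∀ k, BlockPositionForL (TransplantBasisLR k))
    (hBL : ∀ k, BlockLeakageForL (TransplantBasisLR k)) : Summit.QuantumFields.YangMills.Theses.LuscherReduction.DressedRitz :=
  OpPlat.dressedRitz_of_operatorPlateau fun k =>
    operatorPlateauAt_of_partsForL (basisPhysL_transplantBasisLR k) (hS k)
      (liftPositionForL_of_block (basisPhysL_transplantBasisLR k) (hBP k) (hBL k) (hS k))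
      (leakageForL_of_blockLeakageForL (basisPhysL_transplantBasisLR k) (hBL k))

end Summit.QuantumFields.YangMills.Theorems.FemtoTransferGap.PolyakovLift

end
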